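import Mathlib
import Summits.QuantumFields.YangMills.Theses.IsotropyFromPowerCounting

/-!
# The sandwich-adjoint identity `⟨Ψ_{XG}, Ψ_{XG'}⟩ = ⟨Ψ_G, Ψ_{PG'}⟩` (OS (4.7) without rotations)

Crux `IsotropyFromPowerCounting.CurvatureSandwichBound` (stmt-QuantumFields-18372), line `Sketch`,
stub `stub_sandwichAdjoint` of the multiple-reflection engine.

Let `S` be a one-species Schwinger family on `ℝ⁴` with reflection positivity along `e₀` and
translation invariance on `⁰𝒮` (`h : OSReconstructionNoE1 S.toLabelled`), `f₁` a one-point test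
function, `a = s e₀` and, for an `n`-point test function `G`,
`X G = f₁ ⊗ T_a G` (the sandwich) and `P G' = T_a (f₁† ⊗ f₁ ⊗ T_a G')` (`f₁† = Θf₁*` the OS adjoint).
Whenever the field vectors exist (time-ordering hypotheses),
`⟨Ψ_{XG}, Ψ_{XG'}⟩ = ⟨Ψ_G, Ψ_{PG'}⟩`: both sides are the value of the single distribution
`𝔖_{2+n+n'}` on the same configuration up to the diagonal translation by `a` of every point
(`Θ(F_a)* = (ΘF*)_{-a}` for temporal `a`, re-association of the appended tensor blocks through the
arity cast `(1+n)+(1+n') = n+(1+(1+n'))`, and translation invariance on the OFF-DIAGONAL test function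
`Θ(XG)* ⊗ XG'`).  This is Osterwalder–Schrader 1973, §4.1 (4.7) (symmetry of `e^{-sH}`), proved
without rotations and for every real `s`.
-/

noncomputable section

open scoped BigOperators SchwartzMap InnerProductSpace
open MeasureTheory Filter Topology
open Literature.MathematicalPhysics.QuantumLattice Literature.MathematicalPhysics.AQFT
  Literature.MathematicalPhysics.QuantumFieldTheory Literature.Probability.LatticeModels
open Summit.QuantumFields.YangMills.Theorems.NPointIsotropy.Negative (E4)

namespace Summit.QuantumFields.YangMills.Theorems.CurvatureSandwichBound.Sketch

/-! ### Arity casts and the temporal shift vector -/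

-- adapted from `OneGap.apply_cast_arity` / `OneGap.cast_arity_apply`
-- (Theorems/MirrorModularBoostsPlanarSpectralConeOneGapKernel.lean)
/-- A Schwinger family does not see an arity cast: if `F'` is `F` read through `Fin.cast`, then
`𝔖_a F = 𝔖_b F'`. -/
theorem schwinger_congr_cast (S : SchwingerFamily E4) {a b : ℕ} (hab : a = b)
    (F : 𝓢((Fin a → E4), ℂ)) (F' : 𝓢((Fin b → E4), ℂ))
    (hFF' : ∀ y, F' y = F (fun i => y (Fin.cast hab i))) : S a F = S b F' := by
  subst hab
  congr 1
  ext y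
  rw [hFF' y]
  rfl

/-- The time reflection of the temporal vector `s e₀ = s • single 0 1` is its negative. -/
theorem timeReflection_smul_single (s : ℝ) :
    timeReflection 4 (s • EuclideanSpace.single (0 : Fin 4) (1 : ℝ) : E4) =
      -(s • EuclideanSpace.single (0 : Fin 4) (1 : ℝ)) := by
  ext i
  rw [timeReflection_apply]
  by_cases hi : i = 0
  · subst hi; simp
  · simp [hi]

/-! ### The pointwise re-association identity -/

/-- **Index/blocks bookkeeping.**  For every configuration `y` of `n + (1 + (1 + n'))` points,
`(ΘG* ⊗ P G') (y) = (Θ(XG)* ⊗ XG')_{a} (y ∘ Fin.cast)`, `a = s e₀`: the four blocks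
`conj G(θ y_{n-1-j})`, `conj f₁(θ y_n + a)`, `f₁(y_{n+1} - a)`, `G'(y_{n+2+j} - 2a)` agree
(on the left of the cast the `G`-block argument is `θ(y - a) - a = θ y` since `θ a = -a`). -/
theorem sandwich_pointwise (s : ℝ) (f₁ : 𝓢((Fin 1 → E4), ℂ)) {n n' : ℕ}
    (G : 𝓢((Fin n → E4), ℂ)) (G' : 𝓢((Fin n' → E4), ℂ))
    (hN : (1 + n) + (1 + n') = n + (1 + (1 + n')))
    (y : Fin (n + (1 + (1 + n'))) → E4) :
    ((osAdjoint G).appendTensor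
        (translateMulti (s • EuclideanSpace.single 0 1)
          ((osAdjoint f₁).appendTensor
            (f₁.appendTensor (translateMulti (s • EuclideanSpace.single 0 1) G'))))) y =
      (translateMulti (s • EuclideanSpace.single 0 1)
        ((osAdjoint (f₁.appendTensor (translateMulti (s • EuclideanSpace.single 0 1) G))).appendTensor
          (f₁.appendTensor (translateMulti (s • EuclideanSpace.single 0 1) G'))))
        (fun i => y (Fin.cast hN i)) := by
  -- the four index identities (values in `Fin (n + (1 + (1 + n')))`)
  have I1 : ∀ i : Fin 1, Fin.cast hN (Fin.castAdd (1 + n') (Fin.rev (Fin.castAdd n i))) =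
      Fin.natAdd n (Fin.castAdd (1 + n') (Fin.rev i)) := fun i => by
    apply Fin.ext; simp only [Fin.val_cast, Fin.val_castAdd, Fin.val_rev, Fin.val_natAdd]; omega
  have I2 : ∀ j : Fin n, Fin.cast hN (Fin.castAdd (1 + n') (Fin.rev (Fin.natAdd 1 j))) =
      Fin.castAdd (1 + (1 + n')) (Fin.rev j) := fun j => by
    apply Fin.ext; simp only [Fin.val_cast, Fin.val_castAdd, Fin.val_rev, Fin.val_natAdd]; omega
  have I3 : ∀ i : Fin 1, Fin.cast hN (Fin.natAdd (1 + n) (Fin.castAdd n' i)) =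
      Fin.natAdd n (Fin.natAdd 1 (Fin.castAdd n' i)) := fun i => by
    apply Fin.ext; simp only [Fin.val_cast, Fin.val_castAdd, Fin.val_natAdd]; omega
  have I4 : ∀ j : Fin n', Fin.cast hN (Fin.natAdd (1 + n) (Fin.natAdd 1 j)) =
      Fin.natAdd n (Fin.natAdd 1 (Fin.natAdd 1 j)) := fun j => by
    apply Fin.ext; simp only [Fin.val_cast, Fin.val_natAdd]; omega
  simp only [SchwartzMap.appendTensor_apply, translateMulti_apply, osAdjoint_apply, Function.comp_def,
    map_sub, timeReflection_smul_single, sub_neg_eq_add, add_sub_cancel_right, I1, I2, I3, I4, map_mul]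
  ring

/-! ### The sandwich-adjoint identity -/

/-- **Sandwich adjoint** (Osterwalder–Schrader 1973, (4.7), without rotations): with `a = s e₀`,
`X G = f₁ ⊗ T_a G` and `P G' = T_a (f₁† ⊗ f₁ ⊗ T_a G')`,
`⟨Ψ_{XG}, Ψ_{XG'}⟩ = ⟨Ψ_G, Ψ_{PG'}⟩`.  Proof: both inner products are Schwinger function values
(`inner_fieldVec_fieldVec`); the right one is `𝔖(Θ(XG)* ⊗ XG')` translated by `a` and read through
the arity cast (`sandwich_pointwise`, `schwinger_congr_cast`), and `Θ(XG)* ⊗ XG' ∈ ⁰𝒮`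
(`isOffDiagonal_appendTensor_osAdjoint`), so translation invariance on `⁰𝒮` removes the shift. -/
theorem stub_sandwichAdjoint (S : SchwingerFamily E4) (h : OSReconstructionNoE1 S.toLabelled)
    (s : ℝ) (f₁ : 𝓢((Fin 1 → E4), ℂ)) {n n' : ℕ} (G : 𝓢((Fin n → E4), ℂ))
    (G' : 𝓢((Fin n' → E4), ℂ)) (hG : IsTimeOrdered G)
    (hXG : IsTimeOrdered (f₁.appendTensor (translateMulti (s • EuclideanSpace.single 0 1) G)))
    (hXG' : IsTimeOrdered (f₁.appendTensor (translateMulti (s • EuclideanSpace.single 0 1) G')))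
    (hPG' : IsTimeOrdered (translateMulti (s • EuclideanSpace.single 0 1)
      ((osAdjoint f₁).appendTensor
        (f₁.appendTensor (translateMulti (s • EuclideanSpace.single 0 1) G'))))) :
    ⟪h.fieldVec (1 + n) (fun _ => ())
        (f₁.appendTensor (translateMulti (s • EuclideanSpace.single 0 1) G)) hXG,
      h.fieldVec (1 + n') (fun _ => ())
        (f₁.appendTensor (translateMulti (s • EuclideanSpace.single 0 1) G')) hXG'⟫_ℂ =
    ⟪h.fieldVec n (fun _ => ()) G hG,
      h.fieldVec (1 + (1 + n')) (fun _ => ())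
        (translateMulti (s • EuclideanSpace.single 0 1)
          ((osAdjoint f₁).appendTensor
            (f₁.appendTensor (translateMulti (s • EuclideanSpace.single 0 1) G')))) hPG'⟫_ℂ := by
  have hN : (1 + n) + (1 + n') = n + (1 + (1 + n')) := by ring
  rw [h.inner_fieldVec_fieldVec _ _ _ _ (isAppendTensorOf_appendTensor _ _),
    h.inner_fieldVec_fieldVec _ _ _ _ (isAppendTensorOf_appendTensor _ _)]
  simp only [SchwingerFamily.toLabelled_apply]
  have hT := h.translationInvariant ((1 + n) + (1 + n')) (fun _ => ())
    (s • EuclideanSpace.single 0 1 : E4) _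
    (OSReconstructionNoE1.isOffDiagonal_appendTensor_osAdjoint hXG hXG')
  simp only [SchwingerFamily.toLabelled_apply] at hT
  rw [← hT]
  exact schwinger_congr_cast S hN _ _ (sandwich_pointwise s f₁ G G' hN)

end Summit.QuantumFields.YangMills.Theorems.CurvatureSandwichBound.Sketch

end
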